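import Summits.QuantumAdvantage.QuantumAdvantage.Theorems.CubicForrelationNearExactIsExactTwelveBetaTransversal

/-!
# Crux `CubicForrelation.NearExactIsExact` (stmt-QuantumAdvantage-14043) — n = 12, configuration `#Z = 768` below `29/32`:
  the transversal 5-flat identity for an ABSTRACT signed indicator of `Z`

Certificate seat `b2b-cforr-cert` (gen 26).  HONEST FRAMING: a finite-slice structure lemma (standard axioms) about cubic Boolean functions on
12 bits; it claims NO value of `θ₁₂`.  NOT summit progress.  It is the first brick of the level-`≥ 6` analysis of the OPEN window
`57/64 < Φ < 29/32` at `n = 12` for the configuration `#Z = 768` (`Z = {W_g/64 even}`), where the residual `e = W_g/64 − (−1)^f` is no longer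
exactly a sign on `Z` and zero off `Z` (as it was at `Φ = 29/32`, gen 25's (β)), but differs from such a "signed indicator" `S` by a
perturbation `π = e − S` with `Σ|π| ≤ (Σe² − 768)/2 < 64`.

`tzs_transversal` is `tbt_transversal` (gen 25, …TwelveBetaTransversal) VERBATIM with the residual `u'' − (−1)^f` replaced by an arbitrary
integer function `S` that (i) is a sign `(−1)^β` on `Z`, (ii) vanishes off `Z`, and (iii) has all parametrised 5-flat sums `≡ 0 (mod 4)` —
hypothesis `hS5`, which for the residual itself is `gh_flat5`; the partner `f` disappears from the statement.  Conclusions as there: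
(A) `m₁ ⊕ ⋯ ⊕ m₆ ∈ P` for the six fibre representatives of `Z = ⊔ mᵢ ⊕ P` (`tbc_fibres`, `#P = 128`), and (B) the six-point sign identity
`β(m₁⊕v) ⊕ β(m₂⊕v⊕t₁) ⊕ β(m₃⊕v⊕t₂) ⊕ β(m₄⊕v⊕t₃) ⊕ β(m₅⊕v⊕t₄) ⊕ β(m₁⊕…⊕m₅⊕v⊕t₁⊕…⊕t₄) = 1` for all `v, tⱼ ∈ P`; hence (`tba_affine`,
gen 25) all six fibre sign patterns are affine and (`tbd_coset_sum`) `Ŝ ∈ 128ℤ`.  The application (…TwelveZ768Div4Dead): when `4 ∣ e` off `Z`,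
`S := (e mod 4)·1_Z` satisfies (i)–(iii) and `ê = Ŝ + π̂` with `|π̂| < 64` contradicts the duality `ê = −64e′` at an even point of the partner.

References: MacWilliams–Sloane (1977) Ch. 13 §3, Ch. 15; R. O'Donnell (2014) §1.4; D. Simon (1994) §3.1.  Axioms: the standard three.
-/

set_option linter.dupNamespace false -- D-0017: single-problem summit ⇒ `QuantumAdvantage.QuantumAdvantage` by design

noncomputable section

namespace Summit.QuantumAdvantage.QuantumAdvantage.Theorems.CubicForrelation.NearExactIsExact

open Finset
open Literature.Computability.QuantumComplexity
open Literature.Computability.QuantumComplexity.BuzetChailloux (bxor zeroVec bxor_bxor_cancel_left bxor_zeroVec zeroVec_bxor bxor_comm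
  bxor_self)
open Literature.Computability.QuantumComplexity.DerivativeWalsh (W)
set_option maxHeartbeats 400000 in
/-- **The transversal 5-flat identity for an abstract signed indicator of `Z`.**  `W_g = 64u''` with `g` cubic on 12 bits, `#Z = 768` for
`Z = {u'' even}`, six fibre representatives `m₁, …, m₆` (`tbc_fibres`); `S` an integer function with all parametrised 5-flat sums
`≡ 0 (mod 4)`, equal to the sign `(−1)^β` on `Z` and to `0` off `Z`.  Then (A) `m₁ ⊕ ⋯ ⊕ m₆ ∈ P` and (B) the six-point sign identity for
every `v, t₁, …, t₄ ∈ P` (module docstring).  `tbt_transversal` is the case `S = u'' − (−1)^f`. [this work] -/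
theorem tzs_transversal (g : (Fin (6 + 6) → Bool) → Bool) (hg : IsDegLeFun 3 g)
    (u'' : (Fin (6 + 6) → Bool) → ℤ) (hu'' : ∀ x, W (fun y => signOf (g y)) x = (2 : ℝ) ^ 6 * (u'' x : ℝ))
    (h768 : #(univ.filter fun x : Fin (6 + 6) → Bool => ¬ Odd (u'' x)) = 768)
    (S : (Fin (6 + 6) → Bool) → ℤ)
    (hS5 : ∀ (b : Fin (6 + 6) → Bool) (a : Fin 5 → Fin (6 + 6) → Bool),
      (4 : ℤ) ∣ ∑ ε : Fin 5 → Bool, S (fun j => b j ^^ decide (Odd #(univ.filter fun i => ε i && a i j))))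
    (β : (Fin (6 + 6) → Bool) → Bool)
    (hβ : ∀ x ∈ (univ.filter fun x : Fin (6 + 6) → Bool => ¬ Odd (u'' x)), S x = sZ (β x))
    (hoff0 : ∀ y, y ∉ (univ.filter fun x : Fin (6 + 6) → Bool => ¬ Odd (u'' x)) → S y = 0)
    (m₁ m₂ m₃ m₄ m₅ m₆ : Fin (6 + 6) → Bool)
    (hm₁ : m₁ ∈ (univ.filter fun x : Fin (6 + 6) → Bool => ¬ Odd (u'' x)))
    (hm₂ : m₂ ∈ (univ.filter fun x : Fin (6 + 6) → Bool => ¬ Odd (u'' x)))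
    (hm₃ : m₃ ∈ (univ.filter fun x : Fin (6 + 6) → Bool => ¬ Odd (u'' x)))
    (hm₄ : m₄ ∈ (univ.filter fun x : Fin (6 + 6) → Bool => ¬ Odd (u'' x)))
    (hm₅ : m₅ ∈ (univ.filter fun x : Fin (6 + 6) → Bool => ¬ Odd (u'' x)))
    (hm₆ : m₆ ∈ (univ.filter fun x : Fin (6 + 6) → Bool => ¬ Odd (u'' x)))
    (hdist : ∀ a b, (a, b) ∈ [(m₁, m₂), (m₁, m₃), (m₁, m₄), (m₁, m₅), (m₁, m₆), (m₂, m₃), (m₂, m₄), (m₂, m₅), (m₂, m₆), (m₃, m₄),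
      (m₃, m₅), (m₃, m₆), (m₄, m₅), (m₄, m₆), (m₅, m₆)] →
      bxor a b ∉ (univ.filter fun a : Fin (6 + 6) → Bool => ∀ x, decide (Odd (u'' (bxor x a))) = decide (Odd (u'' x))))
    (hcov : ∀ x ∈ (univ.filter fun x : Fin (6 + 6) → Bool => ¬ Odd (u'' x)),
      bxor m₁ x ∈ (univ.filter fun a : Fin (6 + 6) → Bool => ∀ x, decide (Odd (u'' (bxor x a))) = decide (Odd (u'' x))) ∨
      bxor m₂ x ∈ (univ.filter fun a : Fin (6 + 6) → Bool => ∀ x, decide (Odd (u'' (bxor x a))) = decide (Odd (u'' x))) ∨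
      bxor m₃ x ∈ (univ.filter fun a : Fin (6 + 6) → Bool => ∀ x, decide (Odd (u'' (bxor x a))) = decide (Odd (u'' x))) ∨
      bxor m₄ x ∈ (univ.filter fun a : Fin (6 + 6) → Bool => ∀ x, decide (Odd (u'' (bxor x a))) = decide (Odd (u'' x))) ∨
      bxor m₅ x ∈ (univ.filter fun a : Fin (6 + 6) → Bool => ∀ x, decide (Odd (u'' (bxor x a))) = decide (Odd (u'' x))) ∨
      bxor m₆ x ∈ (univ.filter fun a : Fin (6 + 6) → Bool => ∀ x, decide (Odd (u'' (bxor x a))) = decide (Odd (u'' x)))) :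
    bxor (bxor (bxor (bxor (bxor m₁ m₂) m₃) m₄) m₅) m₆ ∈
      (univ.filter fun a : Fin (6 + 6) → Bool => ∀ x, decide (Odd (u'' (bxor x a))) = decide (Odd (u'' x))) ∧
    ∀ v ∈ (univ.filter fun a : Fin (6 + 6) → Bool => ∀ x, decide (Odd (u'' (bxor x a))) = decide (Odd (u'' x))),
    ∀ t₁ ∈ (univ.filter fun a : Fin (6 + 6) → Bool => ∀ x, decide (Odd (u'' (bxor x a))) = decide (Odd (u'' x))),
    ∀ t₂ ∈ (univ.filter fun a : Fin (6 + 6) → Bool => ∀ x, decide (Odd (u'' (bxor x a))) = decide (Odd (u'' x))),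
    ∀ t₃ ∈ (univ.filter fun a : Fin (6 + 6) → Bool => ∀ x, decide (Odd (u'' (bxor x a))) = decide (Odd (u'' x))),
    ∀ t₄ ∈ (univ.filter fun a : Fin (6 + 6) → Bool => ∀ x, decide (Odd (u'' (bxor x a))) = decide (Odd (u'' x))),
      (β (bxor m₁ v) ^^ β (bxor m₂ (bxor v t₁)) ^^ β (bxor m₃ (bxor v t₂)) ^^ β (bxor m₄ (bxor v t₃)) ^^ β (bxor m₅ (bxor v t₄)) ^^
        β (bxor (bxor (bxor (bxor (bxor m₁ m₂) m₃) m₄) m₅) (bxor (bxor (bxor (bxor v t₁) t₂) t₃) t₄))) = true := by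
  classical
  set Z := (univ.filter fun x : Fin (6 + 6) → Bool => ¬ Odd (u'' x)) with hZdef
  set P := (univ.filter fun a : Fin (6 + 6) → Bool => ∀ x, decide (Odd (u'' (bxor x a))) = decide (Odd (u'' x))) with hPdef
  have hβ' : ∀ x ∈ Z, S x = sZ (β x) := hβ
  have hoff0' : ∀ y, y ∉ Z → S y = 0 := hoff0
  have hP0 : zeroVec ∈ P := tbc_P_zero u''
  have hPadd : ∀ a ∈ P, ∀ b ∈ P, bxor a b ∈ P := tbc_P_add u''
  have hZst : ∀ x ∈ Z, ∀ a ∈ P, bxor x a ∈ Z := fun x hx a ha => tbc_Z_stable u'' hx ha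
  -- the six representatives as a set
  set M := ({m₁, m₂, m₃, m₄, m₅, m₆} : Finset (Fin (6 + 6) → Bool)) with hMdef
  obtain ⟨hM6, hpairM⟩ := tbl_six_set u'' m₁ m₂ m₃ m₄ m₅ m₆ hdist
  have i₁ : m₁ ∈ M := by simp [hMdef]
  have i₂ : m₂ ∈ M := by simp [hMdef]
  have i₃ : m₃ ∈ M := by simp [hMdef]
  have i₄ : m₄ ∈ M := by simp [hMdef]
  have i₅ : m₅ ∈ M := by simp [hMdef]
  have i₆ : m₆ ∈ M := by simp [hMdef]
  have hMZ : ∀ a ∈ M, a ∈ Z := by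
    intro a ha
    simp only [hMdef, mem_insert, mem_singleton] at ha
    rcases ha with rfl | rfl | rfl | rfl | rfl | rfl <;> assumption
  have hcovM : ∀ x ∈ Z, ∃ a ∈ M, bxor a x ∈ P := by
    intro x hx
    rcases hcov x hx with h | h | h | h | h | h
    · exact ⟨m₁, i₁, h⟩
    · exact ⟨m₂, i₂, h⟩
    · exact ⟨m₃, i₃, h⟩
    · exact ⟨m₄, i₄, h⟩
    · exact ⟨m₅, i₅, h⟩
    · exact ⟨m₆, i₆, h⟩
  have hne : ∀ a b, bxor a b ∉ P → a ≠ b := by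
    rintro a b h rfl; rw [bxor_self] at h; exact h hP0
  have n12 := hne _ _ (hdist m₁ m₂ (by simp)); have n13 := hne _ _ (hdist m₁ m₃ (by simp))
  have n14 := hne _ _ (hdist m₁ m₄ (by simp)); have n15 := hne _ _ (hdist m₁ m₅ (by simp))
  have n23 := hne _ _ (hdist m₂ m₃ (by simp)); have n24 := hne _ _ (hdist m₂ m₄ (by simp))
  have n25 := hne _ _ (hdist m₂ m₅ (by simp)); have n34 := hne _ _ (hdist m₃ m₄ (by simp))
  have n35 := hne _ _ (hdist m₃ m₅ (by simp)); have n45 := hne _ _ (hdist m₄ m₅ (by simp))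
  have d56 := hdist m₅ m₆ (by simp)
  -- no four labels dependent (`tbl_no_four`), and its consequences off `Z`
  have NF : ∀ {a b c d : Fin (6 + 6) → Bool}, a ∈ M → b ∈ M → c ∈ M → d ∈ M → a ≠ b → a ≠ c → a ≠ d → b ≠ c → b ≠ d → c ≠ d →
      bxor (bxor a b) (bxor c d) ∉ P :=
    fun ha hb hc hd => tbl_no_four g hg u'' hu'' h768 M hM6 hMZ hpairM hcovM ha hb hc hd
  have T3 : ∀ {a b c : Fin (6 + 6) → Bool}, a ∈ M → b ∈ M → c ∈ M → a ≠ b → a ≠ c → b ≠ c →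
      ∀ p ∈ P, bxor (bxor (bxor a b) c) p ∉ Z := by
    intro a b c ha hb hc hab hac hbc p hp hx
    obtain ⟨m, hm, hmx⟩ := hcovM _ hx
    have h4 : bxor (bxor m a) (bxor b c) ∈ P := by
      have := hPadd _ hmx _ hp; rwa [tbt_idM] at this
    by_cases hma : m = a
    · subst hma; rw [bxor_self, zeroVec_bxor] at h4; exact hpairM _ hb _ hc hbc h4
    by_cases hmb : m = b
    · subst hmb; rw [tbt_idb] at h4; exact hpairM _ ha _ hc hac h4
    by_cases hmc : m = c
    · subst hmc; rw [tbt_idc] at h4; exact hpairM _ ha _ hb hab h4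
    · exact NF hm ha hb hc hma hmb hmc hab hac hbc h4
  have T5 : bxor (bxor (bxor (bxor (bxor m₁ m₂) m₃) m₄) m₅) m₆ ∉ P → ∀ p ∈ P, bxor (bxor (bxor (bxor (bxor m₁ m₂) m₃) m₄) m₅) p ∉ Z := by
    intro hr p hp hx
    obtain ⟨m, hm, hmx⟩ := hcovM _ hx
    have h5 : bxor m (bxor (bxor (bxor (bxor m₁ m₂) m₃) m₄) m₅) ∈ P := by
      have := hPadd _ hmx _ hp; rwa [tbt_idT] at this
    simp only [hMdef, mem_insert, mem_singleton] at hm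
    rcases hm with rfl | rfl | rfl | rfl | rfl | rfl
    · rw [tbt_s1] at h5; exact NF i₂ i₃ i₄ i₅ n23 n24 n25 n34 n35 n45 h5
    · rw [tbt_s2] at h5; exact NF i₁ i₃ i₄ i₅ n13 n14 n15 n34 n35 n45 h5
    · rw [tbt_s3] at h5; exact NF i₁ i₂ i₄ i₅ n12 n14 n15 n24 n25 n45 h5
    · rw [tbt_s4] at h5; exact NF i₁ i₂ i₃ i₅ n12 n13 n15 n23 n25 n35 h5
    · rw [tbt_s5] at h5; exact NF i₁ i₂ i₃ i₄ n12 n13 n14 n23 n24 n34 h5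
    · rw [bxor_comm] at h5; exact hr h5
  -- the hyperplane containing `Z`, and a direction `u` leaving it
  obtain ⟨z₀, u, t, ht, hu, hZt⟩ := tbt_hyperplane g hg u'' hu'' h768
  have txl : ∀ x y : Fin (6 + 6) → Bool, twist (bxor x y) z₀ = twist x z₀ * twist y z₀ := fun x y => Simon.twist_xor_left x y z₀
  have htt : t * t = 1 := by rcases ht with rfl | rfl <;> norm_num
  have ht0 : t ≠ 0 := by rcases ht with rfl | rfl <;> norm_num
  have hPt : ∀ p ∈ P, twist p z₀ = 1 := by
    intro p hp
    have h1 := hZt _ (hZst _ hm₁ _ hp)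
    rw [txl, hZt _ hm₁] at h1
    rcases Simon.twist_eq_one_or p z₀ with h | h
    · exact h
    · exfalso; rw [h] at h1; apply ht0; linarith
  have hoffZ : ∀ x, twist x z₀ = -t → x ∉ Z := by
    intro x hx hxZ; rw [hZt x hxZ] at hx; apply ht0; linarith
  -- the 5-flat computation
  have main : ∀ v ∈ P, ∀ t₁ ∈ P, ∀ t₂ ∈ P, ∀ t₃ ∈ P, ∀ t₄ ∈ P,
      (4 : ℤ) ∣ S (bxor m₁ v) + S (bxor m₂ (bxor v t₁)) + S (bxor m₃ (bxor v t₂)) + S (bxor m₄ (bxor v t₃)) + S (bxor m₅ (bxor v t₄)) +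
        S (bxor (bxor (bxor (bxor (bxor m₁ m₂) m₃) m₄) m₅) (bxor (bxor (bxor (bxor v t₁) t₂) t₃) t₄)) := by
    intro v hv t₁ ht₁ t₂ ht₂ t₃ ht₃ t₄ ht₄
    obtain ⟨B, hB⟩ : ∃ B : Fin (6 + 6) → Bool, B = bxor m₁ v := ⟨_, rfl⟩
    obtain ⟨D₁, hD₁⟩ : ∃ D : Fin (6 + 6) → Bool, D = bxor (bxor m₁ m₂) t₁ := ⟨_, rfl⟩
    obtain ⟨D₂, hD₂⟩ : ∃ D : Fin (6 + 6) → Bool, D = bxor (bxor m₁ m₃) t₂ := ⟨_, rfl⟩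
    obtain ⟨D₃, hD₃⟩ : ∃ D : Fin (6 + 6) → Bool, D = bxor (bxor m₁ m₄) t₃ := ⟨_, rfl⟩
    obtain ⟨D₄, hD₄⟩ : ∃ D : Fin (6 + 6) → Bool, D = bxor (bxor m₁ m₅) t₄ := ⟨_, rfl⟩
    have h5 : (4 : ℤ) ∣ ∑ ε : Fin 5 → Bool, S (fun j => B j ^^ decide (Odd #(univ.filter fun i =>
        ε i && (![u, D₁, D₂, D₃, D₄] : Fin 5 → Fin (6 + 6) → Bool) i j))) := hS5 B ![u, D₁, D₂, D₃, D₄]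
    rw [fr_sum_peel S B u ![D₁, D₂, D₃, D₄]] at h5
    -- the `u`-translates leave the hyperplane
    set V₀ := (univ.filter fun d : Fin (6 + 6) → Bool => twist d z₀ = 1) with hV₀
    have hV0 : zeroVec ∈ V₀ := mem_filter.2 ⟨mem_univ _, by simp [twist, zeroVec]⟩
    have hQ : ∀ x : Fin (6 + 6) → Bool, twist x z₀ = t → ∀ a ∈ V₀, twist (bxor x a) z₀ = t := fun x hx a ha => by
      rw [txl, hx, (mem_filter.1 ha).2, mul_one]
    have hBt : twist B z₀ = t := by rw [hB, txl, hZt _ hm₁, hPt _ hv, mul_one]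
    have mkV : ∀ m t', m ∈ Z → t' ∈ P → bxor (bxor m₁ m) t' ∈ V₀ := fun m t' hm ht' =>
      mem_filter.2 ⟨mem_univ _, by rw [txl, txl, hZt _ hm₁, hZt _ hm, hPt _ ht', htt, one_mul]⟩
    have hVD₁ : D₁ ∈ V₀ := hD₁ ▸ mkV m₂ t₁ hm₂ ht₁
    have hVD₂ : D₂ ∈ V₀ := hD₂ ▸ mkV m₃ t₂ hm₃ ht₂
    have hVD₃ : D₃ ∈ V₀ := hD₃ ▸ mkV m₄ t₃ hm₄ ht₃
    have hVD₄ : D₄ ∈ V₀ := hD₄ ▸ mkV m₅ t₄ hm₅ ht₄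
    have hDs : ∀ i, (![D₁, D₂, D₃, D₄] : Fin 4 → Fin (6 + 6) → Bool) i ∈ V₀ := by
      intro i; fin_cases i <;> assumption
    have hflat : ∀ ε : Fin 4 → Bool, twist (fun j => B j ^^ decide (Odd #(univ.filter fun i =>
        ε i && (![D₁, D₂, D₃, D₄] : Fin 4 → Fin (6 + 6) → Bool) i j))) z₀ = t :=
      ws_flatPt_mem V₀ hV0 (fun x => twist x z₀ = t) hQ 4 B hBt ![D₁, D₂, D₃, D₄] hDs
    have hz : ∑ ε : Fin 4 → Bool, S (bxor (fun j => B j ^^ decide (Odd #(univ.filter fun i =>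
        ε i && (![D₁, D₂, D₃, D₄] : Fin 4 → Fin (6 + 6) → Bool) i j))) u) = 0 :=
      sum_eq_zero fun ε _ => hoff0' _ (hoffZ _ (by rw [txl, hflat ε, hu, mul_neg_one]))
    rw [hz, add_zero, fr_sum4] at h5
    -- the sixteen points: ten lie off `Z`
    have z4 : S (bxor (bxor B D₂) D₁) = 0 := by
      rw [hB, hD₁, hD₂, tbt_id2]
      exact hoff0' _ (T3 i₁ i₂ i₃ n12 n13 n23 _ (hPadd _ (hPadd _ hv _ ht₁) _ ht₂))
    have z6 : S (bxor (bxor B D₃) D₁) = 0 := by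
      rw [hB, hD₁, hD₃, tbt_id2]
      exact hoff0' _ (T3 i₁ i₂ i₄ n12 n14 n24 _ (hPadd _ (hPadd _ hv _ ht₁) _ ht₃))
    have z7 : S (bxor (bxor B D₃) D₂) = 0 := by
      rw [hB, hD₂, hD₃, tbt_id2]
      exact hoff0' _ (T3 i₁ i₃ i₄ n13 n14 n34 _ (hPadd _ (hPadd _ hv _ ht₂) _ ht₃))
    have z8 : S (bxor (bxor (bxor B D₃) D₂) D₁) = 0 := by
      rw [hB, hD₁, hD₂, hD₃, tbt_id3]
      exact hoff0' _ (T3 i₂ i₃ i₄ n23 n24 n34 _ (hPadd _ (hPadd _ (hPadd _ hv _ ht₁) _ ht₂) _ ht₃))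
    have z10 : S (bxor (bxor B D₄) D₁) = 0 := by
      rw [hB, hD₁, hD₄, tbt_id2]
      exact hoff0' _ (T3 i₁ i₂ i₅ n12 n15 n25 _ (hPadd _ (hPadd _ hv _ ht₁) _ ht₄))
    have z11 : S (bxor (bxor B D₄) D₂) = 0 := by
      rw [hB, hD₂, hD₄, tbt_id2]
      exact hoff0' _ (T3 i₁ i₃ i₅ n13 n15 n35 _ (hPadd _ (hPadd _ hv _ ht₂) _ ht₄))
    have z12 : S (bxor (bxor (bxor B D₄) D₂) D₁) = 0 := by
      rw [hB, hD₁, hD₂, hD₄, tbt_id3]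
      exact hoff0' _ (T3 i₂ i₃ i₅ n23 n25 n35 _ (hPadd _ (hPadd _ (hPadd _ hv _ ht₁) _ ht₂) _ ht₄))
    have z13 : S (bxor (bxor B D₄) D₃) = 0 := by
      rw [hB, hD₃, hD₄, tbt_id2]
      exact hoff0' _ (T3 i₁ i₄ i₅ n14 n15 n45 _ (hPadd _ (hPadd _ hv _ ht₃) _ ht₄))
    have z14 : S (bxor (bxor (bxor B D₄) D₃) D₁) = 0 := by
      rw [hB, hD₁, hD₃, hD₄, tbt_id3]
      exact hoff0' _ (T3 i₂ i₄ i₅ n24 n25 n45 _ (hPadd _ (hPadd _ (hPadd _ hv _ ht₁) _ ht₃) _ ht₄))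
    have z15 : S (bxor (bxor (bxor B D₄) D₃) D₂) = 0 := by
      rw [hB, hD₂, hD₃, hD₄, tbt_id3]
      exact hoff0' _ (T3 i₃ i₄ i₅ n34 n35 n45 _ (hPadd _ (hPadd _ (hPadd _ hv _ ht₂) _ ht₃) _ ht₄))
    -- the six points in (or conditionally in) `Z`
    have k2 : S (bxor B D₁) = S (bxor m₂ (bxor v t₁)) := by
      rw [hB, hD₁, tbt_id1]
    have k3 : S (bxor B D₂) = S (bxor m₃ (bxor v t₂)) := by
      rw [hB, hD₂, tbt_id1]
    have k5 : S (bxor B D₃) = S (bxor m₄ (bxor v t₃)) := by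
      rw [hB, hD₃, tbt_id1]
    have k9 : S (bxor B D₄) = S (bxor m₅ (bxor v t₄)) := by
      rw [hB, hD₄, tbt_id1]
    have k16 : S (bxor (bxor (bxor (bxor B D₄) D₃) D₂) D₁) = S (bxor (bxor (bxor (bxor (bxor m₁ m₂) m₃) m₄) m₅) (bxor (bxor (bxor (bxor v t₁) t₂) t₃) t₄)) := by
      rw [hB, hD₁, hD₂, hD₃, hD₄, tbt_id4]
    rw [z4, z6, z7, z8, z10, z11, z12, z13, z14, z15, k2, k3, k5, k9, k16, hB] at h5
    simpa only [add_zero] using h5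
  -- (A): `r ∈ P`, else five signs would sum to `0 mod 4`
  have hA : bxor (bxor (bxor (bxor (bxor m₁ m₂) m₃) m₄) m₅) m₆ ∈ P := by
    by_contra hr
    have h := main zeroVec hP0 zeroVec hP0 zeroVec hP0 zeroVec hP0 zeroVec hP0
    simp only [bxor_zeroVec] at h
    have hS : S (bxor (bxor (bxor (bxor m₁ m₂) m₃) m₄) m₅) = 0 := hoff0' _ (by simpa only [bxor_zeroVec] using T5 hr zeroVec hP0)
    rw [hS, add_zero, hβ' _ hm₁, hβ' _ hm₂, hβ' _ hm₃, hβ' _ hm₄, hβ' _ hm₅] at h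
    exact tbt_five _ _ _ _ _ h
  refine ⟨hA, fun v hv t₁ ht₁ t₂ ht₂ t₃ ht₃ t₄ ht₄ => ?_⟩
  have h := main v hv t₁ ht₁ t₂ ht₂ t₃ ht₃ t₄ ht₄
  have hT : (bxor (bxor (bxor (bxor v t₁) t₂) t₃) t₄) ∈ P := hPadd _ (hPadd _ (hPadd _ (hPadd _ hv _ ht₁) _ ht₂) _ ht₃) _ ht₄
  have hlast : bxor (bxor (bxor (bxor (bxor m₁ m₂) m₃) m₄) m₅) (bxor (bxor (bxor (bxor v t₁) t₂) t₃) t₄) ∈ Z := by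
    rw [tbt_idL (bxor (bxor (bxor (bxor m₁ m₂) m₃) m₄) m₅) m₆]
    exact hZst _ hm₆ _ (hPadd _ hA _ hT)
  rw [hβ' _ (hZst _ hm₁ _ hv), hβ' _ (hZst _ hm₂ _ (hPadd _ hv _ ht₁)), hβ' _ (hZst _ hm₃ _ (hPadd _ hv _ ht₂)),
    hβ' _ (hZst _ hm₄ _ (hPadd _ hv _ ht₃)), hβ' _ (hZst _ hm₅ _ (hPadd _ hv _ ht₄)), hβ' _ hlast] at h
  exact tbt_six _ _ _ _ _ _ h

end Summit.QuantumAdvantage.QuantumAdvantage.Theorems.CubicForrelation.NearExactIsExact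

end
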